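import Summits.Ventures.QEC.Thresholds.PlanarSurfaceCodePhenomSAWBox
import Literature.InformationTheory.QuantumCodes.PlanarCodeDrawing
import HarnessLib

/-!
# Planar surface codes under INHOMOGENEOUS space-time noise (every qubit fault and every measurement fault of every round
# independent with its own rate `≤ ρ`), `H_X` record: failure sums `→ 0` for every `ρ < p₀(4.7476)`, in particular all rates
# `≤ .0112`, every minimum-weight space-time decoder family — unconditional, tier CERTIFIED (kernel), failure-sum form

Venture QEC, `Summits/Ventures/QEC/Thresholds/` (LADDER-QEC rung Q5, PARTITION row 09 "phenomenological"; qec-type-09 gen 7, line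
D50.L6 «L-PHENOM», planar companion). Item 135 (C)/(C′) certified the planar memory experiment at `p₀(4.7476) > .0112` for `q = p`
and for the two-rate box `p, q < .0112` (`PlanarSurfaceCodePhenomSAWThresholds.lean`, `PlanarSurfaceCodePhenomSAWBox.lean`).
`PlanarCodeDrawing.lean` re-draws the `H_X` sector with the generic machinery of this line and proves the space-time counting bound
for an ARBITRARY field of fault rates `≤ ρ` (varying with the qubit, the check and the round); this file packages it as
FAILURE SUMS `Σ_{E : D fails on E} w_r(E)` (no threshold VALUE is defined for a rate field):

| theorem | statement | tier |
|---|---|---|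
| `planar_stInhom_belowThreshold_of_sawCountBound3` | `cₙ(ℤ³) ≤ C νⁿ`, rates `≤ ρ ≤ 1/2`, `4ν² ρ(1-ρ) < 1` ⇒ failure sums `→ 0` (poly schedule, every minimum-weight space-time decoder family of the `H_X` record) | CERTIFIED (kernel), parametric |
| `planar_stInhom_belowThreshold_of_connectiveConstant_three_le` | `μ(ℤ³) ≤ μ'`, rates `≤ ρ < p₀(μ')` ⇒ `→ 0` | CERTIFIED (kernel), parametric |
| ★ `planar_stInhom_belowThreshold_kernelZ3SymmK12`, `planar_stInhom_belowThreshold_0112` | rates `≤ ρ < p₀(4.7476)` — in particular **all rates `≤ .0112`** — ⇒ failure sums of the planar memory experiment `→ 0` | CERTIFIED (kernel), unconditional |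

HONEST FRAMING. `H_X` record only (the `H_Z` record would follow by re-indexing the drawing along the planar self-duality; not in
this file). Certified statements about failure SUMS under a rate field bounded by `ρ`; decimals from the kernel certificate
`μ(ℤ³) ≤ 4.7476`. No `native_decide`, no named fact.

## References

* [DennisEtAl2002] E. Dennis, A. Kitaev, A. Landahl, J. Preskill, *Topological quantum memory*, J. Math. Phys. 43 (2002)
  4452–4505, arXiv:quant-ph/0110143, §4.2 (independent faults on the links of the space-time lattice), §5.2 eq. (28), §5.3 eqs.
  (saw_3), (threshold_iso), (threshold_iso_num).
* [PonitzTittmann2000] Electron. J. Combin. 7 (2000) R21, Table 2 (`d = 3, k = 12`).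
-/

noncomputable section

namespace Summit.Ventures.QEC.Thresholds

open Filter Topology Finset Matrix
open Literature.InformationTheory.QuantumCodes
open Literature.InformationTheory.QuantumCodes.PlanarCode
open Literature.InformationTheory.QuantumCodes.ToricCode (SAWCountBound3 IsPolyBounded)
open Literature.Probability.RandomPlanarGeometry

open Classical in
/-- **Planar `H_X` record, inhomogeneous space-time noise: failure sums `→ 0` when `4ν² ρ(1-ρ) < 1`** (`cₙ(ℤ³) ≤ C νⁿ`, `ν > 0`;
every polynomially bounded schedule `T`, every family `D k` of minimum-weight space-time decoders of the `X`-check record, every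
family of rate fields `r k` on the fault locations with `0 ≤ r k ℓ ≤ ρ ≤ 1/2`).
[cite: DennisEtAl2002, §5.3 eq. (threshold_iso) with §5.2 eq. (28) (p̃ at the largest rate)] -/
theorem planar_stInhom_belowThreshold_of_sawCountBound3 {C ν : ℝ} (hν : 0 < ν) (hC : SAWCountBound3 C ν) {T : ℕ → ℕ}
    (hT : IsPolyBounded T) (D : ∀ k, CSSPhenom.STDecoder (PlanarCheck k) (PlanarQubit k) (T k))
    (hD : ∀ k, (D k).IsMinWeight (CSSPhenom.stSyn (planarHX k) (T k)) (CSSPhenom.stCycles (planarHX k) (T k)) hammingNorm)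
    (r : ∀ k, HistoryLoc (PlanarQubit k) (PlanarCheck k) (T k) → ℝ) {ρ : ℝ} (hρ0 : 0 ≤ ρ) (hr0 : ∀ k ℓ, 0 ≤ r k ℓ)
    (hrρ : ∀ k ℓ, r k ℓ ≤ ρ) (hρ : ρ ≤ 1 / 2) (h4 : 4 * ν ^ 2 * (ρ * (1 - ρ)) < 1) :
    Tendsto (fun k => ∑ E ∈ univ.filter (fun E : CSSPhenom.History (PlanarCheck k) (PlanarQubit k) (T k) =>
        ¬ (D k).Corrects (CSSPhenom.stSyn (planarHX k) (T k))
          (CSSPhenom.stTrivial (planarSZ k : Set (PlanarQubit k → ZMod 2)) (T k)) E),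
        indepWeight (r k) (supp E)) atTop (𝓝 0) := by
  have ht := planar_st_tendsto_sum_indepWeight_oddResidual hν hC hT D hD r hρ0 hr0 hrρ hρ h4
  have hw : ∀ k E, 0 ≤ indepWeight (r k) (supp E) := fun k E =>
    indepWeight_nonneg (hr0 k) (fun ℓ => (hrρ k ℓ).trans (by linarith)) _
  refine squeeze_zero' (Filter.Eventually.of_forall fun k => Finset.sum_nonneg fun E _ => hw k E)
    (Filter.Eventually.of_forall fun k => ?_) ht
  refine Finset.sum_le_sum_of_subset_of_nonneg (fun E hE => ?_) fun E _ _ => hw k E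
  rw [Finset.mem_filter] at hE ⊢
  exact ⟨Finset.mem_univ _, planar_phenom_oddResidual_of_not_corrects k (T k) (hD k) hE.2⟩

open Classical in
/-- **Planar `H_X` record, inhomogeneous space-time noise, from any bound on `μ(ℤ³)`**: `μ(ℤ³) ≤ μ'` (`μ' ≥ 1`), all rates
`≤ ρ < p₀(μ')` ⇒ failure sums `→ 0`. [cite: DennisEtAl2002, §5.3 eqs. (saw_3), (threshold_iso_num)] -/
theorem planar_stInhom_belowThreshold_of_connectiveConstant_three_le {μ' : ℝ} (hμ'1 : 1 ≤ μ')
    (hμ : SAW.Zd.connectiveConstant 3 ≤ μ') {T : ℕ → ℕ} (hT : IsPolyBounded T)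
    (D : ∀ k, CSSPhenom.STDecoder (PlanarCheck k) (PlanarQubit k) (T k))
    (hD : ∀ k, (D k).IsMinWeight (CSSPhenom.stSyn (planarHX k) (T k)) (CSSPhenom.stCycles (planarHX k) (T k)) hammingNorm)
    (r : ∀ k, HistoryLoc (PlanarQubit k) (PlanarCheck k) (T k) → ℝ) {ρ : ℝ} (hρ0 : 0 ≤ ρ) (hr0 : ∀ k ℓ, 0 ≤ r k ℓ)
    (hrρ : ∀ k ℓ, r k ℓ ≤ ρ) (hρ : ρ < thresholdValue μ') :
    Tendsto (fun k => ∑ E ∈ univ.filter (fun E : CSSPhenom.History (PlanarCheck k) (PlanarQubit k) (T k) =>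
        ¬ (D k).Corrects (CSSPhenom.stSyn (planarHX k) (T k))
          (CSSPhenom.stTrivial (planarSZ k : Set (PlanarQubit k → ZMod 2)) (T k)) E),
        indepWeight (r k) (supp E)) atTop (𝓝 0) := by
  have hρh : ρ ≤ 1 / 2 := hρ.le.trans (thresholdValue_le_half μ')
  obtain ⟨ν, hν, h4⟩ := exists_gt_four_mul_sq_lt_one_of_lt_thresholdValue hμ'1 hρ0 hρ
  obtain ⟨C, hC⟩ := exists_sawCountBound3_of_connectiveConstant_lt (lt_of_le_of_lt hμ hν)
  exact planar_stInhom_belowThreshold_of_sawCountBound3 (by linarith) hC hT D hD r hρ0 hr0 hrρ hρh h4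

open Classical in
/-- ★ **Planar `H_X` record: all space-time fault rates `≤ ρ < p₀(4.7476)` ⇒ failure sums `→ 0`** (every polynomially bounded
schedule, every minimum-weight space-time decoder family, every rate field) — UNCONDITIONAL, tier CERTIFIED (kernel).
[cite: DennisEtAl2002, §5.3 eq. (threshold_iso_num)] [cite: PonitzTittmann2000, Table 2 (d = 3, k = 12)] -/
theorem planar_stInhom_belowThreshold_kernelZ3SymmK12 {T : ℕ → ℕ} (hT : IsPolyBounded T)
    (D : ∀ k, CSSPhenom.STDecoder (PlanarCheck k) (PlanarQubit k) (T k))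
    (hD : ∀ k, (D k).IsMinWeight (CSSPhenom.stSyn (planarHX k) (T k)) (CSSPhenom.stCycles (planarHX k) (T k)) hammingNorm)
    (r : ∀ k, HistoryLoc (PlanarQubit k) (PlanarCheck k) (T k) → ℝ) {ρ : ℝ} (hρ0 : 0 ≤ ρ) (hr0 : ∀ k ℓ, 0 ≤ r k ℓ)
    (hrρ : ∀ k ℓ, r k ℓ ≤ ρ) (hρ : ρ < thresholdValue 4.7476) :
    Tendsto (fun k => ∑ E ∈ univ.filter (fun E : CSSPhenom.History (PlanarCheck k) (PlanarQubit k) (T k) =>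
        ¬ (D k).Corrects (CSSPhenom.stSyn (planarHX k) (T k))
          (CSSPhenom.stTrivial (planarSZ k : Set (PlanarQubit k → ZMod 2)) (T k)) E),
        indepWeight (r k) (supp E)) atTop (𝓝 0) :=
  planar_stInhom_belowThreshold_of_connectiveConstant_three_le (by norm_num)
    SAW.Zd.FiniteMemory3.connectiveConstant_three_le_47476 hT D hD r hρ0 hr0 hrρ hρ

open Classical in
/-- **Decimal**: all space-time fault rates in `[0, .0112]` ⇒ the failure sums of the planar memory experiment (`H_X` record)
tend to `0` — UNCONDITIONAL, tier CERTIFIED (kernel). [cite: DennisEtAl2002, §5.3 eq. (threshold_iso_num)] -/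
theorem planar_stInhom_belowThreshold_0112 {T : ℕ → ℕ} (hT : IsPolyBounded T)
    (D : ∀ k, CSSPhenom.STDecoder (PlanarCheck k) (PlanarQubit k) (T k))
    (hD : ∀ k, (D k).IsMinWeight (CSSPhenom.stSyn (planarHX k) (T k)) (CSSPhenom.stCycles (planarHX k) (T k)) hammingNorm)
    (r : ∀ k, HistoryLoc (PlanarQubit k) (PlanarCheck k) (T k) → ℝ) (hr0 : ∀ k ℓ, 0 ≤ r k ℓ)
    (hr : ∀ k ℓ, r k ℓ ≤ 0.0112) :
    Tendsto (fun k => ∑ E ∈ univ.filter (fun E : CSSPhenom.History (PlanarCheck k) (PlanarQubit k) (T k) =>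
        ¬ (D k).Corrects (CSSPhenom.stSyn (planarHX k) (T k))
          (CSSPhenom.stTrivial (planarSZ k : Set (PlanarQubit k → ZMod 2)) (T k)) E),
        indepWeight (r k) (supp E)) atTop (𝓝 0) := by
  have h := thresholdValue_47476_bounds.1
  exact planar_stInhom_belowThreshold_kernelZ3SymmK12 hT D hD r (by norm_num) hr0 hr (by linarith)

end Summit.Ventures.QEC.Thresholds
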